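/-
Copyright (c) 2026. All rights reserved.
Released under Apache 2.0 license as described in the file LICENSE.
Authors: abc-iut cell, prover seat abc-iut-L4-d3 (gen 9; row «COR510iv-HOL-MONO-SUPERDIAGRAM-TYPE», abc-iut-L4-lead m170 (M2)),
over abc-iut-L4-t3's `Cor55Telecore` / `Cor510MonoTelecore` and abc-iut-w5-d144's `monoTelecoreDiagram` (consumed BY NAME).
-/
import Literature.AnabelianGeometry.AbsoluteAnabelian.LogFrobeniusMonoTelecoreObservables
import HarnessLib

/-!
# [AbsTopIII] Cor 5.10 (iv)(c): `ℋ_{An⊢}` on `𝔗_{An⊢}` is compatible with `𝔗_{An•}`, `ℋ_{An•}` — typed in the common super-diagram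

S. Mochizuki, *Topics in absolute anabelian geometry III: global reconstruction algorithms* [MochizukiAbsTopIII2015];
locators `p.N` = pages of the author's manuscript (`paper:url-5493eb38cbb7`), read on the page (own render):
Cor 5.10 (iv)(c) p. 148 l. 41–45 ("Moreover, the resulting homotopies `η⊢_{v,ν}`, `(η⊢_{v,ν})⁻¹`, together with the
mono-analyticization homotopies and the homotopies on `D_{An⊢}` arising from the `ι^{An⊢⊞}_{v,ε}` [cf. Proposition 5.8,
(vii)], generate a contact structure `ℋ_{An⊢}` on `𝔗_{An⊢}` **that is compatible with the telecore and contact structures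
`𝔗_{An•}`, `ℋ_{An•}` of Corollary 5.5, (ii)**, as well as with the homotopies of the observables …"), Cor 5.5 (ii)
pp. 130–131 (`𝔗_{An•}`, `ℋ_{An•}`), Def 3.5 (ii) p. 75 l. 26–30 ("compatible": "there exists a family of homotopies `ℋ`
on `𝒟` such that, for each `ι`, `E_{ℋ_ι} ⊆ E_ℋ` and `ζ^ι_ϖ = ζ_ϖ`"), Def 3.5 (iv) p. 76 (telecores, contact structures).

STATEMENTS-FIRST DEFS file (the cell's missing decl «M2» of node AbsTopIII:Cor5.10(iv), abc-iut-L4-lead m170): the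
bold sentence was left untyped by abc-iut-w5-d144's `Cor510MonoTelecoreObservablesCompatible` /
`Cor510MonoContactObservablesCompatible` (honest scope there: "the two telecore diagrams `D_{An•}`, `D_{An⊢}` are
different extensions of `D•_{≤5}`, a common super-diagram is needed").  In the tree the two telecores are ONE-vertex
extensions of DIFFERENT full sub-diagrams of `D•⊢`: `D_{An•}` extends `D•_{≤5}` (`DVertex.InFirstRows 5`) by a copy of
`An•[𝒳]` (abc-iut-L4-t3's `Cor55Telecore`), `D_{An⊢}` extends `D•⊢_{≤5} ∪ D•_{≤6}` (`monoBase 6`) by a copy of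
`An⊢[𝒩⊢⊞]` (abc-iut-w5-d144's `monoTelecoreDiagram`).  Since `D•_{≤5} ⊆ D•⊢_{≤5} ∪ D•_{≤6}` (`monoBase_six_of_inFive`),
the common super-diagram is the SECOND extension of `D_{An⊢}` by the telecore vertex of `𝔗_{An•}`:

* `holMonoShape Jh Jm` / `holMonoDiagram` — `D_{An⊢}` (telecore edges `Jm`) extended by a new vertex carrying `An•[𝒳]`,
  receiving copies of the arrows of `D•⊢` into `An•[𝒳]` from the base vertices and emitting the telecore edges `Jh` of
  `𝔗_{An•}` (lifted along `D•_{≤5} ⊆ D•⊢_{≤5} ∪ D•_{≤6}`);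
* `embMonoSuper` : `Γ⃗_{D_{An⊢}} ↪ Γ⃗_{super}` (base inclusion) and `embHolSuper` : `Γ⃗_{D_{An•}} ↪ Γ⃗_{super}`;
* `CompatibleAlongMonoSuper K H` / `CompatibleAlongHolSuper K H` — Def 3.5 (ii) ACROSS the inclusions: every boundary
  pair of `H` maps to a boundary pair of `K` with (heterogeneously) the same homotopy — the convention of
  abc-iut-L4-t3's `CompatibleIn` and abc-iut-w5-d144's `CompatibleInMonoTelecorePlus` (print tacitly identifies a
  family on a sub-diagram with a family on the big diagram supported inside it; here the identification is explicit);
* ★ `Cor510MonoContactHolCompatible L` — the bold sentence: the telecore `𝔗_{An•}` with a contact structure `ℋ_{An•}`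
  (the binders of `Cor55Telecore` VERBATIM: telecore edges pinned to `TelecoreIdx` / `telecoreFun`), the telecore
  `𝔗_{An⊢}` with a contact structure `ℋ_{An⊢}` (the telecore binders of `Cor510MonoTelecore` VERBATIM: edges pinned to
  `MonoTelecoreIdx` / `monoTelecoreFun`), and ONE family of homotopies `K` on the common super-diagram containing
  `𝒥_{An⊢}`, `ℋ_{An⊢}` along `embMonoSuper` and `𝒥_{An•}`, `ℋ_{An•}` along `embHolSuper`;
* bookkeeping: `cor55Telecore_of_contactHolCompatible` (★ refines Cor 5.5 (ii) as typed).

HONEST SCOPE.  (1) "compatible" is Def 3.5 (ii) read in the common super-diagram with the transport along the two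
sub-diagram inclusions made explicit (as for `s_b′`, p484312); (2) the verb "generate" (the named generators of
`ℋ_{An⊢}`, `ℋ_{An•}`) is NOT typed — the contact structures are binders, exactly as in `Cor55Telecore` /
`Cor510MonoTelecore` ("the generators are not pinned — TODO(general form)"); the pinned pairs `(γ¹_{v,ν}, γ⁰_{v,ν})` of
Cor 5.10 (iv)(c) and the observable clauses are the SEPARATE typed rows `Cor510MonoTelecorePinned`,
`Cor510MonoContactObservablesCompatible` (closed at the genuine carrier, p497899) — this file types only the missing
sentence; (3) every `Prop` here is an ASSUMPTION on `L` asserted by the text for the genuine theaters (typed ≠ proved);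
a closer at a genuine carrier is a separate successor row (it needs one saturated family containing two telecore
families and two contact structures across the column `An•[𝒳] → An⊢[𝒩⊢⊞]` — a two-core analogue of abc-iut-w4-d095's
`cor510MonoContactObservablesCompatible_of`, not attempted here).  MODEL-LEVEL conventions of the §5 interface
(abc-iut-L4-t9).  Refereed pre-IUT material; nothing here bears on [IUTchIII] Cor. 3.12; no side taken.
-/

set_option autoImplicit false

universe u

open CategoryTheory Quiver

namespace Literature.AnabelianGeometry.AbsoluteAnabelian

namespace LogFrobeniusSetting

open AbsTopIII DiagramOfCategories

variable {Vmod : Type u} {isArc : Vmod → Bool} (L : LogFrobeniusSetting Vmod isArc)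

/-! ## `D•_{≤5} ⊆ D•⊢_{≤5} ∪ D•_{≤6}` -/

/-- `D•_{≤5} ⊆ D•⊢_{≤5} ∪ D•_{≤6}`: the base of `𝔗_{An•}` lies in the base of `𝔗_{An⊢}`.
[cite: MochizukiAbsTopIII2015, Cor 5.10 (iv)(a) p. 147] -/
theorem _root_.Literature.AnabelianGeometry.AbsoluteAnabelian.monoBase_six_of_inFive {x : DVertex Vmod isArc}
    (h : x.InFirstRows 5) : monoBase (isArc := isArc) 6 x :=
  Or.inl ⟨h.1, le_trans h.2 (by decide)⟩

/-! ## The telecore diagram `D_{An•}` of Cor 5.5 (ii) (the term on which `Cor55Telecore` places `𝒥_{An•}`, `ℋ_{An•}`) -/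

/-- the shape of `D_{An•}`: `D•_{≤5}` extended by the core vertex `An•[𝒳]` (observation edges = the arrows of `D•` into
`An•[𝒳]`) with telecore edges `Jh`. [cite: MochizukiAbsTopIII2015, Cor 5.5 (ii) p. 130] -/
abbrev holTelecoreShape (Jh : DSub (DVertex.InFirstRows (Vmod := Vmod) (isArc := isArc) 5) → Type u) :
    ExtShape.{u} (DSub (DVertex.InFirstRows (Vmod := Vmod) (isArc := isArc) 5)) :=
  ⟨(obsShape (DVertex.InFirstRows (isArc := isArc) 5) DVertex.an).I, Jh⟩

/-- the diagram of categories `D_{An•}` of the telecore `𝔗_{An•}`, for telecore edges `Jh` realised by functors `telh` — the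
SAME term as the diagram of `T.Jfam` for a telecore `T` over the core `An•[𝒳]` of `D•_{≤5}` (`Cor55Telecore`).
[cite: MochizukiAbsTopIII2015, Cor 5.5 (ii) p. 130] -/
abbrev holTelecoreDiagram (Jh : DSub (DVertex.InFirstRows (Vmod := Vmod) (isArc := isArc) 5) → Type u)
    (telh : ∀ {a : DSub (DVertex.InFirstRows (Vmod := Vmod) (isArc := isArc) 5)}, Jh a → (L.An ⥤ a.1.category L)) :=
  (L.subdiagram (DVertex.InFirstRows 5)).extend (X := holTelecoreShape Jh)
    ⟨(L.obsExt (DVertex.InFirstRows 5) .an).S, (L.obsExt (DVertex.InFirstRows 5) .an).obsMap, telh⟩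

/-! ## The common super-diagram: `D_{An⊢}` extended by the telecore vertex of `𝔗_{An•}` -/

/-- the telecore edges of `𝔗_{An•}` seen from a vertex of `D•⊢_{≤5} ∪ D•_{≤6}`: those of `Jh` if the vertex lies in
`D•_{≤5}`, none otherwise. [cite: MochizukiAbsTopIII2015, Cor 5.5 (ii) p. 130] -/
def HolIdxLift (Jh : DSub (DVertex.InFirstRows (Vmod := Vmod) (isArc := isArc) 5) → Type u)
    (a : DSub (monoBase (Vmod := Vmod) (isArc := isArc) 6)) : Type u :=
  Σ' h : a.1.InFirstRows 5, Jh ⟨a.1, h⟩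

/-- **the shape of the common super-diagram** of `D_{An•}` and `D_{An⊢}`: the vertex set of `D_{An⊢}` (telecore edges `Jm`)
extended by ONE new vertex — the telecore vertex `An•[𝒳]` of `𝔗_{An•}` — receiving copies of the arrows of `D•⊢` into
`An•[𝒳]` from the base vertices and emitting the telecore edges of `𝔗_{An•}`; no edge between the two telecore vertices.
[cite: MochizukiAbsTopIII2015, Cor 5.10 (iv)(c) p. 148] -/
def holMonoShape (Jh : DSub (DVertex.InFirstRows (Vmod := Vmod) (isArc := isArc) 5) → Type u)
    (Jm : DSub (monoBase (Vmod := Vmod) (isArc := isArc) 6) → Type u) :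
    ExtShape.{u} ((monoTelecoreShape (Vmod := Vmod) (isArc := isArc) Jm).Vertex) where
  I a := match a with
    | ExtVertex.base a => DEdge isArc a.1 DVertex.an
    | ExtVertex.obs => PEmpty.{u + 1}
  J a := match a with
    | ExtVertex.base a => HolIdxLift Jh a
    | ExtVertex.obs => PEmpty.{u + 1}

/-- **the common super-diagram** of `D_{An•}` and `D_{An⊢}` as a diagram of categories: abc-iut-w5-d144's
`monoTelecoreDiagram Jm telm` (= `D_{An⊢}`) extended by `An•[𝒳]` with the functors of `D•⊢` along the arrows into `An•[𝒳]`
and the telecore functors `telh` of `𝔗_{An•}`. [cite: MochizukiAbsTopIII2015, Cor 5.10 (iv)(c) p. 148] -/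
def holMonoDiagram (Jh : DSub (DVertex.InFirstRows (Vmod := Vmod) (isArc := isArc) 5) → Type u)
    (Jm : DSub (monoBase (Vmod := Vmod) (isArc := isArc) 6) → Type u)
    (telh : ∀ {a : DSub (DVertex.InFirstRows (Vmod := Vmod) (isArc := isArc) 5)}, Jh a → (L.An ⥤ a.1.category L))
    (telm : ∀ {a : DSub (monoBase (Vmod := Vmod) (isArc := isArc) 6)}, Jm a → (L.AnMono ⥤ a.1.category L)) :
    DiagramOfCategories.{u, u + 1, u} (holMonoShape (Vmod := Vmod) (isArc := isArc) Jh Jm).Vertex :=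
  (L.monoTelecoreDiagram Jm telm).extend (X := holMonoShape Jh Jm)
    { S := (L.obsExt (DVertex.InFirstRows 5) .an).S
      obsMap := fun {a} i => match a, i with
        | ExtVertex.base _, i => DEdge.functor L i
      telMap := fun {a} j => match a, j with
        | ExtVertex.base _, j => telh j.2 }

/-! ## The two inclusions of oriented graphs -/

/-- `Γ⃗_{D_{An⊢}} ↪ Γ⃗_{super}`: the base inclusion (vertices and arrows to themselves).
[cite: MochizukiAbsTopIII2015, Cor 5.10 (iv)(c) p. 148] -/
def embMonoSuper (Jh : DSub (DVertex.InFirstRows (Vmod := Vmod) (isArc := isArc) 5) → Type u)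
    (Jm : DSub (monoBase (Vmod := Vmod) (isArc := isArc) 6) → Type u) :
    (monoTelecoreShape (Vmod := Vmod) (isArc := isArc) Jm).Vertex ⥤q
      (holMonoShape (Vmod := Vmod) (isArc := isArc) Jh Jm).Vertex where
  obj a := ExtVertex.base a
  map e := e

/-- `Γ⃗_{D_{An•}} ↪ Γ⃗_{super}`: a base vertex `x ∈ D•_{≤5}` to the base vertex `x ∈ D•⊢_{≤5} ∪ D•_{≤6}`, the telecore vertex
`An•[𝒳]` to the new vertex; arrows of `D•`, observation arrows into `An•[𝒳]` and telecore edges to themselves.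
[cite: MochizukiAbsTopIII2015, Cor 5.10 (iv)(c) p. 148] -/
def embHolSuper (Jh : DSub (DVertex.InFirstRows (Vmod := Vmod) (isArc := isArc) 5) → Type u)
    (Jm : DSub (monoBase (Vmod := Vmod) (isArc := isArc) 6) → Type u) :
    (holTelecoreShape (Vmod := Vmod) (isArc := isArc) Jh).Vertex ⥤q
      (holMonoShape (Vmod := Vmod) (isArc := isArc) Jh Jm).Vertex where
  obj a := match a with
    | ExtVertex.base a => ExtVertex.base (ExtVertex.base ⟨a.1, monoBase_six_of_inFive a.2⟩)
    | ExtVertex.obs => ExtVertex.obs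
  map {a b} e := match a, b, e with
    | ExtVertex.base _, ExtVertex.base _, e => e
    | ExtVertex.base _, ExtVertex.obs, i => i
    | ExtVertex.obs, ExtVertex.base a, j => (⟨a.2, j⟩ : HolIdxLift Jh ⟨a.1, monoBase_six_of_inFive a.2⟩)
    | ExtVertex.obs, ExtVertex.obs, e => PEmpty.elim e

/-! ## Def 3.5 (ii) across the inclusions -/

/-- a family of homotopies `H` on `D_{An⊢}` EMBEDS into a family `K` on the common super-diagram: every boundary pair of `H`
maps along `embMonoSuper` to a boundary pair of `K` with the same homotopy (Def 3.5 (ii) "compatible families", across the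
sub-diagram inclusion). [cite: MochizukiAbsTopIII2015, Def 3.5 (ii) p. 75] -/
def CompatibleAlongMonoSuper (Jh : DSub (DVertex.InFirstRows (Vmod := Vmod) (isArc := isArc) 5) → Type u)
    (Jm : DSub (monoBase (Vmod := Vmod) (isArc := isArc) 6) → Type u)
    (telh : ∀ {a : DSub (DVertex.InFirstRows (Vmod := Vmod) (isArc := isArc) 5)}, Jh a → (L.An ⥤ a.1.category L))
    (telm : ∀ {a : DSub (monoBase (Vmod := Vmod) (isArc := isArc) 6)}, Jm a → (L.AnMono ⥤ a.1.category L))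
    (K : (L.holMonoDiagram Jh Jm telh telm).HomotopyFamily) (H : (L.monoTelecoreDiagram Jm telm).HomotopyFamily) : Prop :=
  ∀ ⦃a b : (monoTelecoreShape (Vmod := Vmod) (isArc := isArc) Jm).Vertex⦄ (p q : Path a b) (h : H.E p q),
    ∃ h' : K.E ((embMonoSuper Jh Jm).mapPath p) ((embMonoSuper Jh Jm).mapPath q), HEq (H.η h) (K.η h')

/-- a family of homotopies `H` on `D_{An•}` EMBEDS into a family `K` on the common super-diagram along `embHolSuper`.
[cite: MochizukiAbsTopIII2015, Def 3.5 (ii) p. 75] -/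
def CompatibleAlongHolSuper (Jh : DSub (DVertex.InFirstRows (Vmod := Vmod) (isArc := isArc) 5) → Type u)
    (Jm : DSub (monoBase (Vmod := Vmod) (isArc := isArc) 6) → Type u)
    (telh : ∀ {a : DSub (DVertex.InFirstRows (Vmod := Vmod) (isArc := isArc) 5)}, Jh a → (L.An ⥤ a.1.category L))
    (telm : ∀ {a : DSub (monoBase (Vmod := Vmod) (isArc := isArc) 6)}, Jm a → (L.AnMono ⥤ a.1.category L))
    (K : (L.holMonoDiagram Jh Jm telh telm).HomotopyFamily) (H : (L.holTelecoreDiagram Jh telh).HomotopyFamily) : Prop :=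
  ∀ ⦃a b : (holTelecoreShape (Vmod := Vmod) (isArc := isArc) Jh).Vertex⦄ (p q : Path a b) (h : H.E p q),
    ∃ h' : K.E ((embHolSuper Jh Jm).mapPath p) ((embHolSuper Jh Jm).mapPath q), HEq (H.η h) (K.η h')

/-! ## Corollary 5.10 (iv)(c): `ℋ_{An⊢}` is compatible with `𝔗_{An•}`, `ℋ_{An•}` -/

/-- ★ **Cor 5.10 (iv)(c), the holomorphic-compatibility sentence** (assumption on `L`): "[the homotopies `η⊢_{v,ν}`,
`(η⊢_{v,ν})⁻¹`, … generate] a contact structure `ℋ_{An⊢}` on `𝔗_{An⊢}` that is compatible with the telecore and contact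
structures `𝔗_{An•}`, `ℋ_{An•}` of Corollary 5.5, (ii)": the telecore `𝔗_{An•}` over the core `An•[𝒳]` of `D•_{≤5}` with
telecore edges `φ_⋏`, `⋏ ∈ L ∪ {□}` given by copies of `φ_{An•}` (the binders of `Cor55Telecore` VERBATIM) and a contact
structure `ℋ_{An•}` on it; the telecore `𝔗_{An⊢}` over the core `An⊢[𝒩⊢⊞]` of `D•⊢_{≤5} ∪ D•_{≤6}` with telecore edges
`φ^{An⊢⊞}_{w,ν}` (the telecore binders of `Cor510MonoTelecore` VERBATIM) and a contact structure `ℋ_{An⊢}` on it; and ONE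
family of homotopies `K` on the common super-diagram containing `𝒥_{An⊢}`, `ℋ_{An⊢}` (along `embMonoSuper`) and `𝒥_{An•}`,
`ℋ_{An•}` (along `embHolSuper`) — Def 3.5 (ii).  NOT typed: the verb "generate" (generators of the contact structures are
not pinned, as in `Cor55Telecore` / `Cor510MonoTelecore`); the pinned pairs and the observable clauses are the separate
rows `Cor510MonoTelecorePinned`, `Cor510MonoContactObservablesCompatible`.
[cite: MochizukiAbsTopIII2015, Cor 5.10 (iv)(c) p. 148] -/
def Cor510MonoContactHolCompatible : Prop :=
  ∃ (Hh : ((L.subdiagram (DVertex.InFirstRows 5)).extend (L.obsExt (DVertex.InFirstRows 5) .an)).HomotopyFamily)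
    (hHh : ∀ ⦃a b : (obsShape (DVertex.InFirstRows (isArc := isArc) 5) DVertex.an).Vertex⦄ ⦃p q : Path a b⦄,
      Hh.E p q → b = (obsShape (DVertex.InFirstRows (isArc := isArc) 5) DVertex.an).obs)
    (hch : (DiagramOfCategories.Observable.mk _ (fun _ => (inferInstance : IsEmpty PEmpty.{u + 1})) _ Hh hHh).IsCore)
    (Th : DiagramOfCategories.Telecore _ _ hch)
    (_ : Th.J = (fun a => TelecoreIdx a.1))
    (_ : HEq (fun (a : DSub (DVertex.InFirstRows (isArc := isArc) 5)) (j : Th.J a) => Th.telMap j)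
      (fun (a : DSub (DVertex.InFirstRows (isArc := isArc) 5)) (j : TelecoreIdx a.1) => L.telecoreFun a.1 j))
    (Hch : (L.holTelecoreDiagram Th.J Th.telMap).HomotopyFamily)
    (_ : DiagramOfCategories.Telecore.IsContactStructure _ Th Hch)
    (Hm : ((L.subdiagram (monoBase (isArc := isArc) 6)).extend (L.obsExt (monoBase 6) .anMono)).HomotopyFamily)
    (hHm : ∀ ⦃a b : (obsShape (monoBase (isArc := isArc) 6) DVertex.anMono).Vertex⦄ ⦃p q : Path a b⦄,
      Hm.E p q → b = (obsShape (monoBase (isArc := isArc) 6) DVertex.anMono).obs)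
    (hcm : (DiagramOfCategories.Observable.mk _ (fun _ => (inferInstance : IsEmpty PEmpty.{u + 1})) _ Hm hHm).IsCore)
    (Tm : DiagramOfCategories.Telecore _ _ hcm)
    (_ : Tm.J = (fun a => MonoTelecoreIdx a.1))
    (_ : HEq (fun (a : DSub (monoBase (isArc := isArc) 6)) (j : Tm.J a) => Tm.telMap j)
      (fun (a : DSub (monoBase (isArc := isArc) 6)) (j : MonoTelecoreIdx a.1) => L.monoTelecoreFun a.1 j))
    (Hcm : (L.monoTelecoreDiagram Tm.J Tm.telMap).HomotopyFamily)
    (_ : DiagramOfCategories.Telecore.IsContactStructure _ Tm Hcm)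
    (K : (L.holMonoDiagram Th.J Tm.J Th.telMap Tm.telMap).HomotopyFamily),
    L.CompatibleAlongMonoSuper Th.J Tm.J Th.telMap Tm.telMap K Tm.Jfam ∧
      L.CompatibleAlongMonoSuper Th.J Tm.J Th.telMap Tm.telMap K Hcm ∧
      L.CompatibleAlongHolSuper Th.J Tm.J Th.telMap Tm.telMap K Th.Jfam ∧
      L.CompatibleAlongHolSuper Th.J Tm.J Th.telMap Tm.telMap K Hch

/-! ## What the statement refines -/

/-- ★ refines Cor 5.5 (ii) as typed (`Cor55Telecore`: the telecore `𝔗_{An•}` with pinned edges admitting a contact structure).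
[cite: MochizukiAbsTopIII2015, Cor 5.5 (ii) p. 130] -/
theorem cor55Telecore_of_contactHolCompatible (h : L.Cor510MonoContactHolCompatible) : L.Cor55Telecore := by
  obtain ⟨Hh, hHh, hch, Th, hJ, htel, Hch, hc, -⟩ := h
  exact ⟨Hh, hHh, hch, Th, hJ, htel, Hch, hc⟩

/-- ★ refines the core clauses: `An•[𝒳]` is a core of `D•_{≤5}` (Cor 5.5 (i), `n = 6`) and `An⊢[𝒩⊢⊞]` a core of
`D•⊢_{≤5} ∪ D•_{≤6}` (Cor 5.10 (iv)(a), `n = 6`). [cite: MochizukiAbsTopIII2015, Cor 5.10 (iv)(a) p. 147] -/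
theorem isCoreOn_pair_of_contactHolCompatible (h : L.Cor510MonoContactHolCompatible) :
    L.IsCoreOn (DVertex.InFirstRows 5) .an ∧ L.IsCoreOn (monoBase 6) .anMono := by
  obtain ⟨Hh, hHh, hch, -, -, -, -, -, Hm, hHm, hcm, -⟩ := h
  exact ⟨⟨Hh, hHh, hch⟩, ⟨Hm, hHm, hcm⟩⟩

/-- **`V(F_mod) ≠ ∅` is necessary as typed** (degenerate boundary, exactly as for the sibling rows `Cor510MonoTelecorePinned`,
`Cor510Mono…ObservablesCompatible`): with `Vmod` empty the vertex `□` has no outgoing arrow, so no core structure with core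
vertex `An⊢[𝒩⊢⊞]` exists (abc-iut-L4-t15's `eq_core_of_path_of_isEmpty`). [cite: MochizukiAbsTopIII2015, Cor 5.10 (iv)(a)(c) pp. 147–148] -/
theorem not_cor510MonoContactHolCompatible_of_isEmpty [IsEmpty Vmod] : ¬ L.Cor510MonoContactHolCompatible := by
  rintro ⟨-, -, -, -, -, -, -, -, Hm, hHm, hcore, -⟩
  obtain ⟨p⟩ := hcore.reaches_obs ⟨.core, monoBase_six_core⟩
  have h := eq_core_of_path_of_isEmpty (P := monoBase 6) monoBase_six_core (x := .anMono)
    (fun i => by cases i) p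
  change ExtVertex.obs = ExtVertex.base _ at h
  cases h

end LogFrobeniusSetting

end Literature.AnabelianGeometry.AbsoluteAnabelian
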